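import Summits.QuantumFields.YangMills.Theorems.UnitScaleTiltProp7SectET3SlotCurrentRowsT3
import Summits.QuantumFields.YangMills.Theorems.UnitScaleTiltProp7SectET3DeltaEtaExplicitT3
import Literature.MathematicalPhysics.QuantumFieldTheory.Balaban1983to89.T3Thm1Carrier
import Literature.MathematicalPhysics.QuantumFieldTheory.Balaban1983to89.B10StarCount
import HarnessLib

/-!
# CERTIFICATE that the RETRACTED, NEVER-DISPLAYED row `hΔπn` (‖currentCLM … DeltaEtaSlot‖ ≤ MΔ, ∀ Idx L) is uninhabitable: ‖·‖_op ≥ 4·L^{K−n} at U₀ = 1; print never uses ‖Δ_π‖ ([5] p.423, [B11] (88)) — typed-letter artefact, nothing of print refuted.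
# Route `UnitScaleTilt`, crux «MinimiserStabilityRegPr» (stmt-QuantumFields-19200), stub `stub_existenceMinimalOrbit` (EX), route (α) — NEGATIVE KNOWLEDGE (★★OWNER ym3-torus-plan g28 GO 2026-08-29T01:05:16Z,
# same standing as ✓`HalvingHSB9AllNotAtCubeMember.hLeaf_false` on the H side): **THE BARE (115)→(−3) OPERATOR NORM OF THE HESSIAN CURRENT `Δ̃^η := currentCLM frobEquiv lev₁ (nabla115 η (bgOfCfg U₀))
# (DeltaEtaSlot U₀)` IS `≥ 4·L^{K−n} − 28ε₀η` AT EVERY PRINTED-REGULAR BACKGROUND**, so no `L`-only bound `MΔ L` uniform over `i : Idx L` exists (`not_hΔπn`)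

PRIOR LOCATE AND CREDIT.  ★ym3-torus-px19 g4, «PROP4-W80 K-UNIFORMITY» 62a4477b29e316fc (19200 evidence #57, 2026-08-29T00:38Z): the same finding nine minutes before this seat's memo
(f59d998ff4297d73, #59), with the better cure — the EXISTING composite engine lit ✓`B11Eq98W80Composite.quadAnalytic_W80_composite` (print's route through `(Δ_π + DRD*)H`); adopted by the
EX namer ★ym-ust-19200-w2 g7 RULING (14) 00:39:25Z, which RETRACTED the would-be row `hΔπn` (and `hC4`@`C4W`) of LOCATE 2a20a1caf0923edd BEFORE any display (★px5 g3's PROP4-W80 door ✓p683940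
carries no such row; ★px19 g4 ✓p683135 `hN₁_family_of_rows` is the composite letter's inhabitant).  This file is the kernel record of WHY: so that no future EX∕E′ display re-introduces a bare
operator-norm bound on `Δ̃π`∕`Δ̃^η` over an unbounded level range (owner's use: namers' inhabitability kits).  No flag was ever opened; nothing displayed was affected.

Cell `ym3-torus`, width seat `ym-ust-20520-w4` (gen 10); LOCATE memo `HOME/ym-ust-20520-w4/g10/LOCATE-HDELTA-NORM-w4g10.md` (19200 evidence #59).  THEOREMS ONLY (0 `def`, 0 `sorry`);
`--supports stmt-QuantumFields-19200 --as helper` (helper mode: closes nothing, claims nothing); count-neutral for the cell's records.  YM₃ on T³ is ladder rung R3, NOT the Clay problem; nothing here claims the stub, the crux, d = 4 or the mass gap;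
NOTHING OF PRINT IS REFUTED — print ([Balaban1985BackgroundPropagators] p.423, (3.123)–(3.126), (3.132); [Balaban1985Variational] p.291 on (88)) never uses a bare operator norm of `Δ_π`:
«derivatives in the operator Δ′π + Δ⁽²⁾ … have to be applied either to the operator on the right, or on the left, because kernels … are not regular enough»; it routes through the
COMPOSITE `Δ_πH = Q*((QGQ*)⁻¹ − a)`.  What is certified false is a TYPED abstraction: the `nΔ := ‖Δπ‖` letter of lit ✓`B11Eq98CurrentSlot.C4W` (HONEST SCOPE (i) there: «uniformity in the
lattice NOT adjudicated here») instantiated at the cell's letter of record `Δ̃π := currentCLM … DeltaEtaSlot …` with an `L`-only bound.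

THE MECHANISM.  At the member the carriers `Space115 (L:ℝ) η lev₀ lev₁ ∇` ∕ `NegSize (L:ℝ) η lev₀ 3` are ONE-LEVEL (`lev₀ ≡ lev₁ ≡ K − n`, `η = (L⁻¹)^{K−n}`), so every weight
`levWeight = (L^{K−n}·η)^m` is `1`: the (115)-norm is `max(sup‖A′‖, sup‖∇^η_{U₀}A′‖)` (ONE `η`-derivative) and the (−3)-size is `sup‖·‖`; the Hessian `Δ^η = η⁻²(D¹*D¹_{U₀} + Δ′₁)`
(✓`Prop7SectET3DeltaEtaExplicit.symm_DeltaEta_toL2_apply`) takes TWO derivatives.  The scalar bump `X = η•1_{b₀}•𝟙` (central values: every transport `R(U)` acts trivially) has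
‖X‖₁₁₅ ≤ 1 and `(D¹*D¹_{U₀}X)(b₀) = 2(d−1)·η•𝟙 = 4η•𝟙` at EVERY background, while `‖Δ′₁X‖ ≤ 28ε₀η²·η` on `RegPr ε₀`; hence `‖(Δ̃X)(b₀)‖ ≥ η⁻²(4η − 28ε₀η³)`.

WHAT IS PROVED (ns `…Theorems.Prop7DeltaEtaCurrentNormLowerBound`).
* §1 torus letters: `one_ne_zero_zmod`, `shift_ne_self`, `unshift_ne_self` (every torus of the series has ≥ 2 sites per direction); §2 `conjR_smul_one` ∕ `covGradT_one_smul_one` ∕ `covCurlT_one_smul_one` ∕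
  `covDerivT_one_smul_one` (central one-forms: every covariant first-order operator at unit spacing is the flat one on the scalar).
* §2 ★ `covCodiffCurlT_one_bump` — on ANY torus `T^{(s)}` of `Setup`, ANY background `V`: `(D¹*_VD¹_V X)(b₀) = (2(d−1)·c)•𝟙` for the scalar bump `X = (c·1_{b₀})•𝟙`.
* §3 ★★ `norm_symm_DeltaEta_toL2_bump_ge` — at a T³ member, `RegPr F n K ε₀ U₀`: `4η⁻¹ − 28ε₀η ≤ ‖toL2⁻¹(Δ^η(toL2 X))(b₀)‖` for the bump with `c = η`.
* §4 ★★★ `opNorm_currentCLM_DeltaEtaSlot_ge` — `4·L^{K−n} − 28·ε₀·(L⁻¹)^{K−n} ≤ ‖currentCLM (L := L) (η := (L⁻¹)^{K−n}) (lev₀ := fun _ ↦ K − n) frobEquiv (fun _ ↦ K − n) (nabla115 ((L⁻¹)^{K−n}) (bgOfCfg F K U₀))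
  (DeltaEtaSlot F n K c₀ U₀)‖` for every `RegPr F n K ε₀ U₀` (any `c₀ > 0`); ★ `four_pow_le_opNorm_currentCLM_DeltaEtaSlot_one` — at `U₀ = 1`: `4·L^{K−n} ≤ ‖…‖`.
* §5 ★★★ `not_hΔπn` — for ALL `c₀ MΔ α : ℕ → ℝ` (`0 < α L`): `¬ (∀ L, 1 < L → ∀ (i : Idx L) U₀, RegPr … (α L) U₀ → ‖Δ̃^η‖ ≤ MΔ L)` (witness: `L = 3`, the member `(F, 0, K)` with `3^K` large, `U₀ = 1`).
HONEST SCOPE.  Elementary lattice bookkeeping over landed letters; the cure of record is lit ✓`B11Eq98W80Composite.quadAnalytic_W80_composite` + ✓p683135 (px19 g4), not this file.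

References: T. Bałaban, CMP **99** (1985) 389–434 [Balaban1985BackgroundPropagators] ((3.10) p.392, (3.123)–(3.126) p.420, (3.132) p.422, p.423); CMP **102** (1985) 277–309
[Balaban1985Variational] ((88) p.291, (97)–(98) p.293, (115) p.294).
-/

set_option autoImplicit false

noncomputable section

open scoped InnerProductSpace ComplexConjugate Matrix.Norms.L2Operator BigOperators

namespace Summit.QuantumFields.YangMills.Theorems.Prop7DeltaEtaCurrentNormLowerBound

open Literature.MathematicalPhysics.QuantumFieldTheory.Balaban1983to89
open Literature.MathematicalPhysics.QuantumFieldTheory.Balaban1983to89.T3ContinuumYM3Torus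
open Literature.MathematicalPhysics.QuantumFieldTheory.Balaban1983to89.T3PrintedRegularMinimiser (RegPr regPr_one)
open Literature.MathematicalPhysics.QuantumFieldTheory.Balaban1983to89.T3Thm1Carrier (Idx)
open Literature.MathematicalPhysics.QuantumFieldTheory.Balaban1983to89.B10StarCount (shift_unshift unshift_shift)
open B7Eq78Linearization (conjR conjR_smul conjR_one)
open T3SectALandauChart (formComp bgUnits covDerivFwdT covGradT covCurlT covCodiffT covCodiffCurlT eta eta_pos)
open B10Eq68TorusRegularity (covDerivT)
open B9SectCLatticeCarrier (Bond)
open B11Eq103H1Complex (BondL2K)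
open B11Eq115Space (NegSup NegSize Space115 JetSup levWeight)
open B11Eq111FrakG (nabla115 nabla115_apply)
open B9Eq3119DeltaPiCarrier (currentCLM)
open Summit.QuantumFields.YangMills.Theorems.Prop7SectET3Transport (periodsT3 bondEquiv bgOfCfg)
open Summit.QuantumFields.YangMills.Theorems.Prop7SectET3HilbertLetters (W₂ frobEquiv toL2)
open Summit.QuantumFields.YangMills.Theorems.Prop7SectET3WilsonHessian (DeltaEta DeltaEtaSlot)
open Summit.QuantumFields.YangMills.Theorems.Prop7SectET3SlotCurrentRows (equiv_currentCLM_slot)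
open Summit.QuantumFields.YangMills.Theorems.Prop7SectET3DeltaEtaExplicit (symm_DeltaEta_toL2_apply norm_deltaPrimeOp_le_of_regPr)

/-! ## §1 Torus letters -/

section Torus

variable {P : Params} {s : ℕ}

/-- Every torus of the series has at least two sites per direction (`2·L^{m+K−s} ≥ 2`), so `1 ≠ 0` in `ZMod (sitesPerDir s)`. [folklore] -/
theorem one_ne_zero_zmod : (1 : ZMod (P.sitesPerDir s)) ≠ 0 := by
  haveI : Fact (1 < P.sitesPerDir s) := ⟨by
    unfold Params.sitesPerDir
    have h1 : 1 ≤ P.L ^ (P.m + P.K - s) := Nat.one_le_pow _ _ P.L_pos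
    omega⟩
  exact one_ne_zero

/-- `x + e_μ ≠ x` on every torus of the series. [folklore] -/
theorem shift_ne_self (x : Site P s) (μ : Fin P.d) : x.shift μ ≠ x := by
  intro h
  have h1 := congrFun h μ
  simp only [Site.shift, Function.update_self] at h1
  exact one_ne_zero_zmod (add_eq_left.1 h1)

/-- `x − e_μ ≠ x` on every torus of the series. [folklore] -/
theorem unshift_ne_self (x : Site P s) (μ : Fin P.d) : x.unshift μ ≠ x := by
  intro h
  have h2 : (x.unshift μ).shift μ = x.shift μ := by rw [h]
  rw [shift_unshift] at h2
  exact shift_ne_self x μ h2.symm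

end Torus

/-! ## §2 The scalar bump: `D¹*_VD¹_V` of `(c·1_{b₀})•𝟙` at `b₀` is `2(d−1)c•𝟙`, at EVERY background -/

section Bump

variable {P : Params} {s : ℕ}

/-- Transport acts trivially on central values: `R(V)(t•𝟙) = t•𝟙`. [folklore] -/
theorem conjR_smul_one (V : (Matrix (Fin 2) (Fin 2) ℂ)ˣ) (t : ℂ) : conjR V (t • (1 : Matrix (Fin 2) (Fin 2) ℂ)) = t • (1 : Matrix (Fin 2) (Fin 2) ℂ) := by
  rw [conjR_smul, conjR_one]

/-- The covariant gradient of a central one-form `X(b) = t(b)•𝟙` is the flat gradient of `t`, at every background (unit spacing). [folklore] -/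
theorem covGradT_one_smul_one (V : GaugeField P s (Matrix (Fin 2) (Fin 2) ℂ)ˣ) (t : PBond P s → ℂ) (μ ν : Fin P.d) (x : Site P s) :
    covGradT 1 V (fun b => t b • (1 : Matrix (Fin 2) (Fin 2) ℂ)) μ ν x = (t ⟨x.shift μ, ν⟩ - t ⟨x, ν⟩) • (1 : Matrix (Fin 2) (Fin 2) ℂ) := by
  simp only [covGradT, covDerivFwdT, formComp, conjR_smul_one, inv_one, one_smul, sub_smul]

/-- The covariant curl of a central one-form is the flat curl of its scalar, at every background (unit spacing). [folklore] -/
theorem covCurlT_one_smul_one (V : GaugeField P s (Matrix (Fin 2) (Fin 2) ℂ)ˣ) (t : PBond P s → ℂ) (μ ν : Fin P.d) (x : Site P s) :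
    covCurlT 1 V (fun b => t b • (1 : Matrix (Fin 2) (Fin 2) ℂ)) μ ν x
      = ((t ⟨x.shift μ, ν⟩ - t ⟨x, ν⟩) - (t ⟨x.shift ν, μ⟩ - t ⟨x, μ⟩)) • (1 : Matrix (Fin 2) (Fin 2) ℂ) := by
  rw [covCurlT, covGradT_one_smul_one, covGradT_one_smul_one, ← sub_smul]

/-- The backward covariant derivative of a central site function `q•𝟙` is the flat backward difference of `q`, at every background (unit spacing). [folklore] -/
theorem covDerivT_one_smul_one (V : GaugeField P s (Matrix (Fin 2) (Fin 2) ℂ)ˣ) (q : Site P s → ℂ) (ν : Fin P.d) (x : Site P s) :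
    covDerivT 1 V ν (fun y => q y • (1 : Matrix (Fin 2) (Fin 2) ℂ)) x = (q (x.unshift ν) - q x) • (1 : Matrix (Fin 2) (Fin 2) ℂ) := by
  simp only [covDerivT, conjR_smul_one, inv_one, one_smul, sub_smul]

/-- ★ **`(D¹*_VD¹_V X)(b₀) = (2(d−1)·c)•𝟙` FOR THE SCALAR BUMP `X = (c·1_{b₀})•𝟙`, AT EVERY BACKGROUND `V`** (unit spacing; the `2(d−1)` plaquettes through `b₀` each return `+c` twice:
print's `D*D` generalises `∂*∂`, [Balaban1985BackgroundPropagators] p.392).  The bump is passed as a scalar `t` with its defining equation `ht`, so consumers instantiate by `rfl`.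
[cite: Balaban1985BackgroundPropagators, (3.8)–(3.10) p.392] -/
theorem covCodiffCurlT_one_bump (V : GaugeField P s (Matrix (Fin 2) (Fin 2) ℂ)ˣ) (x₀ : Site P s) (μ₀ : Fin P.d) (c : ℂ) (t : PBond P s → ℂ)
    (ht : ∀ b, t b = if b.src = x₀ ∧ b.dir = μ₀ then c else 0) :
    covCodiffCurlT 1 V (fun b : PBond P s => t b • (1 : Matrix (Fin 2) (Fin 2) ℂ)) μ₀ x₀ = ((2 * ((P.d - 1 : ℕ) : ℂ)) * c) • (1 : Matrix (Fin 2) (Fin 2) ℂ) := by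
  have tv : ∀ (y : Site P s) (ν : Fin P.d), t ⟨y, ν⟩ = if y = x₀ ∧ ν = μ₀ then c else 0 := fun y ν => ht ⟨y, ν⟩
  -- each term of the first sum (`ν < μ₀`): `D¹*_ν (D¹X)_{νμ₀}` at `x₀` is `2c•𝟙`
  have hterm : ∀ ν, ν ≠ μ₀ → covDerivT 1 V ν (covCurlT 1 V (fun b : PBond P s => t b • (1 : Matrix (Fin 2) (Fin 2) ℂ)) ν μ₀) x₀ = (2 * c) • (1 : Matrix (Fin 2) (Fin 2) ℂ) := by
    intro ν hν
    have hc : covCurlT 1 V (fun b : PBond P s => t b • (1 : Matrix (Fin 2) (Fin 2) ℂ)) ν μ₀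
        = fun y => ((t ⟨y.shift ν, μ₀⟩ - t ⟨y, μ₀⟩) - (t ⟨y.shift μ₀, ν⟩ - t ⟨y, ν⟩)) • (1 : Matrix (Fin 2) (Fin 2) ℂ) :=
      funext fun y => covCurlT_one_smul_one V t ν μ₀ y
    rw [hc, covDerivT_one_smul_one, shift_unshift]
    simp only [tv, hν, and_false, if_false, and_true, shift_ne_self, unshift_ne_self, if_true, sub_zero]
    congr 1
    ring
  -- each term of the second sum (`μ₀ < ν`): `D¹*_ν (D¹X)_{μ₀ν}` at `x₀` is `−2c•𝟙`
  have hterm' : ∀ ν, ν ≠ μ₀ → covDerivT 1 V ν (covCurlT 1 V (fun b : PBond P s => t b • (1 : Matrix (Fin 2) (Fin 2) ℂ)) μ₀ ν) x₀ = -((2 * c) • (1 : Matrix (Fin 2) (Fin 2) ℂ)) := by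
    intro ν hν
    have hc : covCurlT 1 V (fun b : PBond P s => t b • (1 : Matrix (Fin 2) (Fin 2) ℂ)) μ₀ ν
        = fun y => ((t ⟨y.shift μ₀, ν⟩ - t ⟨y, ν⟩) - (t ⟨y.shift ν, μ₀⟩ - t ⟨y, μ₀⟩)) • (1 : Matrix (Fin 2) (Fin 2) ℂ) :=
      funext fun y => covCurlT_one_smul_one V t μ₀ ν y
    rw [hc, covDerivT_one_smul_one, shift_unshift, ← neg_smul]
    simp only [tv, hν, and_false, if_false, and_true, shift_ne_self, unshift_ne_self, if_true, sub_zero]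
    congr 1
    ring
  rw [covCodiffCurlT, covCodiffT, Finset.sum_congr rfl fun ν hν => hterm ν (Finset.mem_Iio.1 hν).ne,
    Finset.sum_congr rfl fun ν hν => hterm' ν (Finset.mem_Ioi.1 hν).ne', Finset.sum_const, Finset.sum_const, Fin.card_Iio, Fin.card_Ioi,
    smul_neg, sub_neg_eq_add, ← add_nsmul]
  have hcard : (μ₀ : ℕ) + (P.d - 1 - μ₀) = P.d - 1 := by have := μ₀.isLt; omega
  rw [hcard, ← Nat.cast_smul_eq_nsmul ℂ, smul_smul]
  congr 1
  ring

end Bump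

/-! ## §3 At a T³ member: the bond value of `Δ^η` on the bump is `≥ 4η⁻¹ − 28ε₀η` on the printed-regular class -/

section Member

variable (F : T3Family) (n K : ℕ) (c₀ : ℝ) [Fact (0 < c₀)]

/-- The bump's values have norm `≤ η`: `‖(if … then η else 0)•𝟙‖ ≤ η`. [folklore] -/
theorem norm_bump_le (b₀ b : PBond (F.P K) 0) :
    ‖(if b.src = b₀.src ∧ b.dir = b₀.dir then ((eta F n K : ℝ) : ℂ) else 0) • (1 : Matrix (Fin 2) (Fin 2) ℂ)‖ ≤ eta F n K := by
  have hη : 0 < eta F n K := eta_pos F n K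
  split_ifs
  · rw [norm_smul, norm_one, mul_one, Complex.norm_real, Real.norm_of_nonneg hη.le]
  · rw [zero_smul, norm_zero]; exact hη.le

/-- ★★ **`4η⁻¹ − 28ε₀η ≤ ‖toL2⁻¹(Δ^η(U₀)(toL2 X))(b₀)‖` FOR THE BUMP `X = (η·1_{b₀})•𝟙` ON `RegPr F n K ε₀ U₀`** — the `D*D` part contributes `η⁻²·4η•𝟙` exactly (§2, `d = 3`), the curvature part
`Δ′₁` at most `η⁻²·28ε₀η²·η` (✓`norm_deltaPrimeOp_le_of_regPr`). [cite: Balaban1985BackgroundPropagators, (3.10) p.392; Balaban1985Variational, (19) p.281] -/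
theorem norm_symm_DeltaEta_toL2_bump_ge {ε₀ : ℝ} (U₀ : GaugeField (F.P K) 0 (Matrix.specialUnitaryGroup (Fin 2) ℂ)) (hreg : RegPr F n K ε₀ U₀)
    (b₀ : PBond (F.P K) 0) :
    4 * (eta F n K)⁻¹ - 28 * ε₀ * eta F n K ≤
      ‖(toL2 F K c₀).symm (DeltaEta F n K c₀ U₀ (toL2 F K c₀
          (fun b : PBond (F.P K) 0 => (if b.src = b₀.src ∧ b.dir = b₀.dir then ((eta F n K : ℝ) : ℂ) else 0) • (1 : Matrix (Fin 2) (Fin 2) ℂ)))) b₀‖ := by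
  have hη : 0 < eta F n K := eta_pos F n K
  rw [symm_DeltaEta_toL2_apply]
  -- the `D*D` part, by §2 at `d = 3`
  have hD : covCodiffCurlT 1 (bgUnits F K U₀)
        (fun b : PBond (F.P K) 0 => (if b.src = b₀.src ∧ b.dir = b₀.dir then ((eta F n K : ℝ) : ℂ) else 0) • (1 : Matrix (Fin 2) (Fin 2) ℂ)) b₀.dir b₀.src
      = ((2 * (((F.P K).d - 1 : ℕ) : ℂ)) * ((eta F n K : ℝ) : ℂ)) • (1 : Matrix (Fin 2) (Fin 2) ℂ) :=
    covCodiffCurlT_one_bump (bgUnits F K U₀) b₀.src b₀.dir _ (fun b => if b.src = b₀.src ∧ b.dir = b₀.dir then ((eta F n K : ℝ) : ℂ) else 0) fun _ => rfl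
  have hDn : ‖covCodiffCurlT 1 (bgUnits F K U₀)
        (fun b : PBond (F.P K) 0 => (if b.src = b₀.src ∧ b.dir = b₀.dir then ((eta F n K : ℝ) : ℂ) else 0) • (1 : Matrix (Fin 2) (Fin 2) ℂ)) b₀.dir b₀.src‖
      = 4 * eta F n K := by
    rw [hD, show (F.P K).d = 3 from rfl, norm_smul, norm_one, mul_one]
    push_cast
    rw [show (2 : ℂ) * 2 * ((eta F n K : ℝ) : ℂ) = (((4 * eta F n K : ℝ)) : ℂ) by push_cast; ring, Complex.norm_real,
      Real.norm_of_nonneg (by positivity)]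
  -- the curvature part
  have hΔ' := norm_deltaPrimeOp_le_of_regPr U₀ hreg (norm_bump_le F n K b₀) b₀.dir b₀.src
  -- assemble: `‖η⁻² • (A + B)‖ ≥ η⁻²(‖A‖ − ‖B‖)`
  rw [norm_smul, Complex.norm_real, Real.norm_of_nonneg (by positivity)]
  have hAB := norm_sub_le
    (covCodiffCurlT 1 (bgUnits F K U₀)
        (fun b : PBond (F.P K) 0 => (if b.src = b₀.src ∧ b.dir = b₀.dir then ((eta F n K : ℝ) : ℂ) else 0) • (1 : Matrix (Fin 2) (Fin 2) ℂ)) b₀.dir b₀.src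
      + B9Eq310Hermitian.deltaPrimeOp (B9TorusCalculus.torusT (F.P K) 0) (fun μ x => bgUnits F K U₀ ⟨x, μ⟩) 1
          (formComp fun b : PBond (F.P K) 0 => (if b.src = b₀.src ∧ b.dir = b₀.dir then ((eta F n K : ℝ) : ℂ) else 0) • (1 : Matrix (Fin 2) (Fin 2) ℂ)) b₀.dir b₀.src)
    (B9Eq310Hermitian.deltaPrimeOp (B9TorusCalculus.torusT (F.P K) 0) (fun μ x => bgUnits F K U₀ ⟨x, μ⟩) 1
          (formComp fun b : PBond (F.P K) 0 => (if b.src = b₀.src ∧ b.dir = b₀.dir then ((eta F n K : ℝ) : ℂ) else 0) • (1 : Matrix (Fin 2) (Fin 2) ℂ)) b₀.dir b₀.src)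
  rw [add_sub_cancel_right, hDn] at hAB
  have hη2 : ((eta F n K)⁻¹ ^ 2) * (4 * eta F n K - 28 * (ε₀ * eta F n K ^ 2) * eta F n K) = 4 * (eta F n K)⁻¹ - 28 * ε₀ * eta F n K := by
    field_simp
  rw [← hη2]
  exact mul_le_mul_of_nonneg_left (by linarith) (by positivity)

end Member

/-! ## §4 ★★★ The operator norm of the Hessian current at the member is `≥ 4·L^{K−n} − 28ε₀η` -/

section OpNorm

variable (F : T3Family) (n K : ℕ) (c₀ : ℝ) [Fact (0 < c₀)] [Fact (0 < (F.L : ℝ))] [Fact (0 < ((F.L : ℝ)⁻¹) ^ (K - n))]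

omit [Fact (0 < c₀)] [Fact (0 < ((F.L : ℝ)⁻¹) ^ (K - n))] in
/-- The one-level weights are all `1`: `(L^{K−n}·(L⁻¹)^{K−n})^m = 1`. [cite: Balaban1985Variational, (115) p.294, p.286] -/
theorem levWeight_member_eq_one {ι : Type*} (m : ℕ) (p : ι) :
    levWeight (F.L : ℝ) (((F.L : ℝ)⁻¹) ^ (K - n)) (fun _ : ι => K - n) m p = 1 := by
  have hL : (F.L : ℝ) ≠ 0 := (Fact.out : 0 < (F.L : ℝ)).ne'
  rw [B11Eq115Space.levWeight_apply, ← mul_pow, mul_inv_cancel₀ hL, one_pow, one_pow]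

/-- Transport acts trivially on central values (units form): `U·(t•𝟙)·U⁻¹ = t•𝟙`. [folklore] -/
theorem units_conj_smul_one (U : (Matrix (Fin 2) (Fin 2) ℂ)ˣ) (t : ℂ) :
    (U : Matrix (Fin 2) (Fin 2) ℂ) * (t • (1 : Matrix (Fin 2) (Fin 2) ℂ)) * ((U⁻¹ : (Matrix (Fin 2) (Fin 2) ℂ)ˣ) : Matrix (Fin 2) (Fin 2) ℂ)
      = t • (1 : Matrix (Fin 2) (Fin 2) ℂ) := by
  rw [mul_smul_comm, smul_mul_assoc, mul_one, Units.mul_inv]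

omit [Fact (0 < c₀)] [Fact (0 < (F.L : ℝ))] [Fact (0 < ((F.L : ℝ)⁻¹) ^ (K - n))] in
/-- Two bump values differ by at most `η` in norm. [folklore] -/
theorem norm_bump_sub_bump_le (P Q : Prop) [Decidable P] [Decidable Q] :
    ‖(if P then ((eta F n K : ℝ) : ℂ) else 0) • (1 : Matrix (Fin 2) (Fin 2) ℂ) - (if Q then ((eta F n K : ℝ) : ℂ) else 0) • (1 : Matrix (Fin 2) (Fin 2) ℂ)‖
      ≤ eta F n K := by
  have hη : 0 < eta F n K := eta_pos F n K
  split_ifs <;>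
    simp [norm_smul, Real.norm_of_nonneg hη.le, hη.le]

/-- ★★★ **THE OPERATOR NORM OF THE HESSIAN CURRENT IS `≥ 4·L^{K−n} − 28·ε₀·(L⁻¹)^{K−n}` ON THE PRINTED-REGULAR CLASS** — at every `RegPr F n K ε₀ U₀`, every weight `c₀ > 0`:
the (115)→(−3) operator norm of `Δ̃^η := currentCLM frobEquiv (fun _ ↦ K − n) (nabla115 η (bgOfCfg U₀)) (DeltaEtaSlot U₀)` at the member's one-level carriers (`lev ≡ K − n`, `η = (L⁻¹)^{K−n}`),
tested on the scalar bump `Y = (η·1_{b₀})•𝟙` (‖Y‖₁₁₅ ≤ 1).  Since `Idx L` leaves `K − n` unbounded, NO `L`-only bound `MΔ L` exists (§5).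
[cite: Balaban1985BackgroundPropagators, (3.10) p.392, p.423; Balaban1985Variational, (115) p.294, (98) p.293] -/
theorem opNorm_currentCLM_DeltaEtaSlot_ge {ε₀ : ℝ} (U₀ : GaugeField (F.P K) 0 (Matrix.specialUnitaryGroup (Fin 2) ℂ)) (hreg : RegPr F n K ε₀ U₀) :
    4 * (F.L : ℝ) ^ (K - n) - 28 * ε₀ * ((F.L : ℝ)⁻¹) ^ (K - n) ≤
      ‖currentCLM (L := (F.L : ℝ)) (η := ((F.L : ℝ)⁻¹) ^ (K - n)) (lev₀ := fun _ : Bond 3 (periodsT3 F K) => K - n) frobEquiv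
          (fun _ : Bond 3 (periodsT3 F K) × Fin 3 => K - n) (nabla115 (((F.L : ℝ)⁻¹) ^ (K - n)) (bgOfCfg F K U₀)) (DeltaEtaSlot F n K c₀ U₀)‖ := by
  have hη : 0 < eta F n K := eta_pos F n K
  have hηdef : ((F.L : ℝ)⁻¹) ^ (K - n) = eta F n K := rfl
  have hη1 : eta F n K ≤ 1 :=
    pow_le_one₀ (inv_nonneg.2 (Fact.out : 0 < (F.L : ℝ)).le) (inv_le_one_of_one_le₀ (by exact_mod_cast F.hL.2.le))
  -- a bond and the bump
  set b₀ : PBond (F.P K) 0 := ⟨default, ⟨0, (F.P K).hd⟩⟩ with hb₀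
  set X : PBond (F.P K) 0 → Matrix (Fin 2) (Fin 2) ℂ :=
    fun b => (if b.src = b₀.src ∧ b.dir = b₀.dir then ((eta F n K : ℝ) : ℂ) else 0) • (1 : Matrix (Fin 2) (Fin 2) ℂ) with hX
  set T := currentCLM (L := (F.L : ℝ)) (η := ((F.L : ℝ)⁻¹) ^ (K - n)) (lev₀ := fun _ : Bond 3 (periodsT3 F K) => K - n) frobEquiv
          (fun _ : Bond 3 (periodsT3 F K) × Fin 3 => K - n) (nabla115 (((F.L : ℝ)⁻¹) ^ (K - n)) (bgOfCfg F K U₀)) (DeltaEtaSlot F n K c₀ U₀) with hT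
  -- the (115)-field reading the bump
  set Y : Space115 (F.L : ℝ) (((F.L : ℝ)⁻¹) ^ (K - n)) (fun _ : Bond 3 (periodsT3 F K) => K - n) (fun _ : Bond 3 (periodsT3 F K) × Fin 3 => K - n)
      (nabla115 (((F.L : ℝ)⁻¹) ^ (K - n)) (bgOfCfg F K U₀)) :=
    (JetSup.equiv _ _ _).symm (fun p : Bond 3 (periodsT3 F K) => X ((bondEquiv F K).symm p)) with hY
  have hYread : (fun b' : PBond (F.P K) 0 => JetSup.equiv _ _ _ Y (bondEquiv F K b')) = X := by
    funext b'
    show X ((bondEquiv F K).symm (bondEquiv F K b')) = X b'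
    rw [Equiv.symm_apply_apply]
  -- ‖Y‖₁₁₅ ≤ 1 (term-mode composition: the norm instance on `Space115` is reached by a different projection path than lit's lemmas', so `rw` does not key-match)
  have hfst : ‖B11Eq115Space.JetSup.fst Y‖ ≤ 1 :=
    (B11Eq115Space.NegSup.norm_le_iff (f := B11Eq115Space.JetSup.fst Y) zero_le_one).2 fun p => by
      rw [B11Eq115Space.JetSup.equiv_fst, levWeight_member_eq_one F n K, one_mul]
      show ‖X ((bondEquiv F K).symm p)‖ ≤ 1
      exact (norm_bump_le F n K b₀ _).trans hη1
  have hsnd : ‖B11Eq115Space.JetSup.snd Y‖ ≤ 1 :=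
    (B11Eq115Space.NegSup.norm_le_iff (f := B11Eq115Space.JetSup.snd Y) zero_le_one).2 fun pν => by
      obtain ⟨p, ν⟩ := pν
      rw [B11Eq115Space.JetSup.equiv_snd, levWeight_member_eq_one F n K, one_mul, nabla115_apply]
      show ‖(((((F.L : ℝ)⁻¹) ^ (K - n) : ℝ) : ℂ))⁻¹ •
          ((bgOfCfg F K U₀ p : Matrix (Fin 2) (Fin 2) ℂ) * X ((bondEquiv F K).symm (B9SectCLatticeCarrier.btgt p, ν)) *
              (((bgOfCfg F K U₀ p)⁻¹ : (Matrix (Fin 2) (Fin 2) ℂ)ˣ) : Matrix (Fin 2) (Fin 2) ℂ)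
            - X ((bondEquiv F K).symm (B9SectCLatticeCarrier.bpos p, ν)))‖ ≤ 1
      rw [hX]
      dsimp only
      rw [units_conj_smul_one, norm_smul, norm_inv, Complex.norm_real, hηdef, Real.norm_of_nonneg hη.le]
      calc (eta F n K)⁻¹ * _ ≤ (eta F n K)⁻¹ * eta F n K :=
            mul_le_mul_of_nonneg_left (norm_bump_sub_bump_le F n K _ _) (inv_nonneg.2 hη.le)
        _ = 1 := inv_mul_cancel₀ hη.ne'
  have hYnorm : ‖Y‖ ≤ 1 := le_trans (le_of_eq (B11Eq115Space.JetSup.norm_def Y)) (max_le hfst hsnd)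
  -- the bond value of `T Y` at `b₀` is `toL2⁻¹(Δ^η(toL2 X))(b₀)`
  have hval : NegSup.equiv (levWeight (F.L : ℝ) (((F.L : ℝ)⁻¹) ^ (K - n)) (fun _ : Bond 3 (periodsT3 F K) => K - n) 3) (Matrix (Fin 2) (Fin 2) ℂ)
        (T Y) (bondEquiv F K b₀) = (toL2 F K c₀).symm (DeltaEta F n K c₀ U₀ (toL2 F K c₀ X)) b₀ := by
    rw [hT, equiv_currentCLM_slot, hYread, Equiv.symm_apply_apply]
    rfl
  -- assemble
  have hηinv : (eta F n K)⁻¹ = (F.L : ℝ) ^ (K - n) := by rw [← hηdef, inv_pow, inv_inv]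
  calc 4 * (F.L : ℝ) ^ (K - n) - 28 * ε₀ * ((F.L : ℝ)⁻¹) ^ (K - n)
      = 4 * (eta F n K)⁻¹ - 28 * ε₀ * eta F n K := by rw [hηinv, hηdef]
    _ ≤ ‖(toL2 F K c₀).symm (DeltaEta F n K c₀ U₀ (toL2 F K c₀ X)) b₀‖ := norm_symm_DeltaEta_toL2_bump_ge F n K c₀ U₀ hreg b₀
    _ = levWeight (F.L : ℝ) (((F.L : ℝ)⁻¹) ^ (K - n)) (fun _ : Bond 3 (periodsT3 F K) => K - n) 3 (bondEquiv F K b₀) *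
          ‖NegSup.equiv (levWeight (F.L : ℝ) (((F.L : ℝ)⁻¹) ^ (K - n)) (fun _ : Bond 3 (periodsT3 F K) => K - n) 3) (Matrix (Fin 2) (Fin 2) ℂ)
              (T Y) (bondEquiv F K b₀)‖ := by rw [hval, levWeight_member_eq_one F n K, one_mul]
    _ ≤ ‖T Y‖ := B11Eq115Space.NegSup.weight_mul_norm_apply_le (f := T Y) (bondEquiv F K b₀)
    _ ≤ ‖T‖ * ‖Y‖ := T.le_opNorm Y
    _ ≤ ‖T‖ * 1 := mul_le_mul_of_nonneg_left hYnorm (norm_nonneg T)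
    _ = ‖T‖ := mul_one _

/-- ★ **AT THE FLAT BACKGROUND `U₀ = 1`: `4·L^{K−n} ≤ ‖Δ̃^η‖`** (`regPr_one` at every radius `ε₀ > 0`, then `ε₀ → 0`). [cite: Balaban1985BackgroundPropagators, (3.10) p.392] -/
theorem four_pow_le_opNorm_currentCLM_DeltaEtaSlot_one :
    4 * (F.L : ℝ) ^ (K - n) ≤
      ‖currentCLM (L := (F.L : ℝ)) (η := ((F.L : ℝ)⁻¹) ^ (K - n)) (lev₀ := fun _ : Bond 3 (periodsT3 F K) => K - n) frobEquiv
          (fun _ : Bond 3 (periodsT3 F K) × Fin 3 => K - n) (nabla115 (((F.L : ℝ)⁻¹) ^ (K - n)) (bgOfCfg F K 1)) (DeltaEtaSlot F n K c₀ 1)‖ := by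
  have hη : 0 < eta F n K := eta_pos F n K
  refine le_of_forall_pos_le_add fun δ hδ => ?_
  have h := opNorm_currentCLM_DeltaEtaSlot_ge F n K c₀ (ε₀ := δ / (28 * eta F n K)) 1 (regPr_one (by positivity))
  have h28 : 28 * (δ / (28 * eta F n K)) * ((F.L : ℝ)⁻¹) ^ (K - n) = δ := by
    rw [show ((F.L : ℝ)⁻¹) ^ (K - n) = eta F n K from rfl]; field_simp
  linarith

end OpNorm

/-! ## §5 ★★★ The displayed-to-be row `hΔπn` is uninhabitable -/

section NotRow

/-- ★★★ **`not_hΔπn` — NO `L`-ONLY BOUND ON ‖Δ̃^η‖ EXISTS**: for all `c₀ MΔ α : ℕ → ℝ` (`0 < c₀ L`, `0 < α L`), the row «`∀ L > 1, ∀ (i : Idx L) U₀, RegPr … (α L) U₀ → ‖currentCLM frobEquiv (fun _ ↦ K − n)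
(nabla115 η (bgOfCfg U₀)) (DeltaEtaSlot … (c₀ L) U₀)‖ ≤ MΔ L`» (the PROP4-W80 door's displayed-to-be `hΔπn`, EX namer LOCATE 2a20a1caf0923edd) is FALSE — witness `L = 3`, the member `(F, 0, K+1)`
with `4·3^{K} > MΔ 3 + 28·α 3`, `U₀ = 1` (§4).  A door displaying this row is true but VACUOUS; the print-faithful cure routes `Δ_π` through `Δ_πH = Q*((QGQ*)⁻¹ − a)` ([Balaban1985BackgroundPropagators]
(3.124)∕(3.126)∕(3.132)). [cite: Balaban1985BackgroundPropagators, (3.126) p.420, (3.132) p.422, p.423; Balaban1985Variational, (88) p.291, (98) p.293] -/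
theorem not_hΔπn [hFL : ∀ F : T3Family, Fact (0 < (F.L : ℝ))] [hFη : ∀ (F : T3Family) (k : ℕ), Fact (0 < ((F.L : ℝ)⁻¹) ^ k)]
    (c₀ : ℕ → ℝ) [hc₀ : ∀ L : ℕ, Fact (0 < c₀ L)] (MΔ α : ℕ → ℝ) (hα : ∀ L, 1 < L → 0 < α L) :
    ¬ (∀ (L : ℕ), 1 < L → ∀ (i : Idx L) (U₀ : GaugeField (i.1.1.P i.1.2.2) 0 (Matrix.specialUnitaryGroup (Fin 2) ℂ)),
        RegPr i.1.1 i.1.2.1 i.1.2.2 (α L) U₀ →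
          ‖currentCLM (L := (i.1.1.L : ℝ)) (η := ((i.1.1.L : ℝ)⁻¹) ^ (i.1.2.2 - i.1.2.1)) (lev₀ := fun _ : Bond 3 (periodsT3 i.1.1 i.1.2.2) => i.1.2.2 - i.1.2.1)
              frobEquiv (fun _ : Bond 3 (periodsT3 i.1.1 i.1.2.2) × Fin 3 => i.1.2.2 - i.1.2.1)
              (nabla115 (((i.1.1.L : ℝ)⁻¹) ^ (i.1.2.2 - i.1.2.1)) (bgOfCfg i.1.1 i.1.2.2 U₀)) (DeltaEtaSlot i.1.1 i.1.2.1 i.1.2.2 (c₀ L) U₀)‖ ≤ MΔ L) := by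
  intro h
  -- the witness family `L = 3`, `m = 1`
  let F : T3Family := ⟨3, ⟨⟨1, by norm_num⟩, by norm_num⟩, 1, le_rfl⟩
  have hF : (F.L : ℝ) = 3 := by show ((3 : ℕ) : ℝ) = 3; norm_num
  obtain ⟨K, hK⟩ := pow_unbounded_of_one_lt ((MΔ 3 + 28 * α 3) / 4) (by norm_num : (1 : ℝ) < 3)
  let i : Idx 3 := ⟨(F, 0, K + 1), rfl, Nat.succ_pos K⟩
  have hreg : RegPr F 0 (K + 1) (α 3) (1 : GaugeField (F.P (K + 1)) 0 (Matrix.specialUnitaryGroup (Fin 2) ℂ)) := regPr_one (hα 3 (by norm_num))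
  have h1 : ‖currentCLM (L := (F.L : ℝ)) (η := ((F.L : ℝ)⁻¹) ^ (K + 1 - 0)) (lev₀ := fun _ : Bond 3 (periodsT3 F (K + 1)) => K + 1 - 0) frobEquiv
      (fun _ : Bond 3 (periodsT3 F (K + 1)) × Fin 3 => K + 1 - 0) (nabla115 (((F.L : ℝ)⁻¹) ^ (K + 1 - 0)) (bgOfCfg F (K + 1) 1))
      (DeltaEtaSlot F 0 (K + 1) (c₀ 3) 1)‖ ≤ MΔ 3 := h 3 (by norm_num) i 1 hreg
  have h2 := four_pow_le_opNorm_currentCLM_DeltaEtaSlot_one F 0 (K + 1) (c₀ 3)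
  have h4 : (3 : ℝ) ^ K ≤ (F.L : ℝ) ^ (K + 1 - 0) := by
    rw [hF, Nat.sub_zero, pow_succ]
    exact le_mul_of_one_le_right (by positivity) (by norm_num)
  have hα3 := hα 3 (by norm_num)
  have h5 : 4 * (F.L : ℝ) ^ (K + 1 - 0) ≤ MΔ 3 := h2.trans h1
  linarith

end NotRow


end Summit.QuantumFields.YangMills.Theorems.Prop7DeltaEtaCurrentNormLowerBound

end
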